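import Mathlib
import HarnessLib

/-!
# Power series with nonnegative coefficients are absolutely monotonic; mirror form (complete monotonicity)

Widder, *The Laplace Transform*, Ch. IV §2: a convergent power series `g(w) = Σ_j a_j w^j` with `a_j ≥ 0` is
ABSOLUTELY MONOTONIC on `[0, ρ)` (`ρ` = radius) — all derivatives exist and are `≥ 0`; they are the termwise
derived series `g^{(k)}(w) = Σ_j a_j · j(j-1)⋯(j-k+1) · w^{j-k}`.  This file gives the elementary real-variable calculus:

* `derivedSeries a k w = Σ' j, a_j · (j.descFactorial k) · w^{j-k}` (`k = 0`: the series itself);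
* `summable_derivedSeries_term` — termwise absolute convergence for `|w| < ρ` when `Σ a_j ρ^j < ∞`;
* `hasDerivAt_derivedSeries` — `(derivedSeries a k)' = derivedSeries a (k+1)` on `(-ρ, ρ)` (termwise differentiation);
* `iteratedDeriv_derivedSeries`, `contDiffOn_derivedSeries`, `derivedSeries_nonneg`;
* the MIRROR form used for Bernstein's theorem: a function which on a neighbourhood `(U/2, U)` of each point of `(0,∞)`
  is `Σ_j a_j (U-u)^j` with `a_j ≥ 0`, `Σ a_j U^j < ∞`, is `C^∞` on `(0,∞)` with `(-1)^n f^{(n)} ≥ 0`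
  (`completelyMonotone_of_local_powerSeries`) [Widder1941, Ch. IV §2 (Definition 2c and Theorem 2b: `f(-x)`)].

## References
* D. V. Widder, *The Laplace Transform*, Princeton 1941, Ch. IV §§2–3. [Widder1941]
-/

noncomputable section

open Filter Topology Set
open scoped BigOperators ContDiff

namespace Literature.Analysis.Calculus

/-- The `k`-th termwise derived series of `Σ_j a_j w^j`: `Σ' j, a_j · j(j-1)⋯(j-k+1) · w^{j-k}`.
[cite: Widder1941, Ch. IV §2] -/
def derivedSeries (a : ℕ → ℝ) (k : ℕ) (w : ℝ) : ℝ :=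
  ∑' j, a j * (j.descFactorial k : ℝ) * w ^ (j - k)

section Basic

variable {a : ℕ → ℝ} {ρ : ℝ}

/-- `derivedSeries a 0` is the power series itself. [cite: Widder1941, Ch. IV §2] -/
theorem derivedSeries_zero (a : ℕ → ℝ) (w : ℝ) : derivedSeries a 0 w = ∑' j, a j * w ^ j := by
  unfold derivedSeries
  simp

/-- The terms of the derived series are nonnegative at `w ≥ 0` when `a_j ≥ 0`. [cite: Widder1941, Ch. IV §2] -/
theorem derivedSeries_nonneg (ha : ∀ j, 0 ≤ a j) (k : ℕ) {w : ℝ} (hw : 0 ≤ w) : 0 ≤ derivedSeries a k w :=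
  tsum_nonneg fun j => mul_nonneg (mul_nonneg (ha j) (Nat.cast_nonneg _)) (pow_nonneg hw _)

/-- A coefficient bound from summability: `a_j ρ^j ≤ Σ_i a_i ρ^i`. [cite: Widder1941, Ch. IV §2] -/
theorem coeff_mul_pow_le_tsum (ha : ∀ j, 0 ≤ a j) (hρ : 0 ≤ ρ) (hs : Summable fun j => a j * ρ ^ j) (j : ℕ) :
    a j * ρ ^ j ≤ ∑' i, a i * ρ ^ i :=
  hs.le_tsum j fun i _ => mul_nonneg (ha i) (pow_nonneg hρ i)

/-- **Termwise absolute convergence inside the radius**: if `Σ a_j ρ^j < ∞` (`a_j ≥ 0`, `ρ > 0`) then for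
`0 < r < ρ` and every `k`, `Σ_j a_j · j^{(k)} · r^{j-k} < ∞`. [cite: Widder1941, Ch. IV §2] -/
theorem summable_derivedSeries_term (ha : ∀ j, 0 ≤ a j) (hρ : 0 < ρ) (hs : Summable fun j => a j * ρ ^ j)
    (k : ℕ) {r : ℝ} (hr0 : 0 < r) (hr : r < ρ) :
    Summable fun j => a j * (j.descFactorial k : ℝ) * r ^ (j - k) := by
  set B : ℝ := ∑' i, a i * ρ ^ i with hB
  have hB0 : 0 ≤ B := tsum_nonneg fun i => mul_nonneg (ha i) (pow_nonneg hρ.le i)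
  have hq : ‖r / ρ‖ < 1 := by
    rw [Real.norm_eq_abs, abs_of_pos (div_pos hr0 hρ), div_lt_one hρ]; exact hr
  have hgeo : Summable fun j : ℕ => ((j : ℝ) ^ k : ℝ) * (r / ρ) ^ j :=
    summable_pow_mul_geometric_of_norm_lt_one k hq
  have hdom : Summable fun j : ℕ => B * (r ^ k)⁻¹ * (((j : ℝ) ^ k : ℝ) * (r / ρ) ^ j) :=
    hgeo.mul_left _
  refine Summable.of_nonneg_of_le (fun j => mul_nonneg (mul_nonneg (ha j) (Nat.cast_nonneg _)) (pow_nonneg hr0.le _))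
    (fun j => ?_) hdom
  by_cases hjk : k ≤ j
  · -- `a_j ≤ B ρ^{-j}`, `descFactorial ≤ j^k`, `r^{j-k} = r^j / r^k`
    have h1 : a j ≤ B / ρ ^ j := by
      rw [le_div_iff₀ (pow_pos hρ j)]; exact coeff_mul_pow_le_tsum ha hρ.le hs j
    have h2 : (j.descFactorial k : ℝ) ≤ (j : ℝ) ^ k := by exact_mod_cast Nat.descFactorial_le_pow j k
    have h3 : r ^ (j - k) = r ^ j * (r ^ k)⁻¹ := by
      rw [pow_sub₀ r hr0.ne' hjk]
    rw [h3]
    have h4 : (r / ρ) ^ j = r ^ j / ρ ^ j := div_pow r ρ j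
    calc a j * (j.descFactorial k : ℝ) * (r ^ j * (r ^ k)⁻¹)
        ≤ (B / ρ ^ j) * (j : ℝ) ^ k * (r ^ j * (r ^ k)⁻¹) := by gcongr
      _ = B * (r ^ k)⁻¹ * ((j : ℝ) ^ k * (r / ρ) ^ j) := by rw [h4]; ring
  · rw [Nat.descFactorial_eq_zero_iff_lt.2 (not_le.1 hjk)]
    simp only [Nat.cast_zero, mul_zero, zero_mul]
    positivity

/-- **Termwise differentiation**: for `|w| < ρ`, `derivedSeries a k` has derivative `derivedSeries a (k+1) w` at `w`.
[cite: Widder1941, Ch. IV §2] -/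
theorem hasDerivAt_derivedSeries (ha : ∀ j, 0 ≤ a j) (hρ : 0 < ρ) (hs : Summable fun j => a j * ρ ^ j) (k : ℕ)
    {w : ℝ} (hw : |w| < ρ) :
    HasDerivAt (derivedSeries a k) (derivedSeries a (k + 1) w) w := by
  -- an intermediate radius
  set r : ℝ := (|w| + ρ) / 2 with hr
  have hr0 : 0 < r := by rw [hr]; linarith [abs_nonneg w]
  have hwr : |w| < r := by rw [hr]; linarith
  have hrρ : r < ρ := by rw [hr]; linarith
  -- the summable bound on the derivatives
  set u : ℕ → ℝ := fun j => a j * (j.descFactorial (k + 1) : ℝ) * r ^ (j - (k + 1)) with hu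
  have hus : Summable u := summable_derivedSeries_term ha hρ hs (k + 1) hr0 hrρ
  have hderiv : ∀ j y, y ∈ Ioo (-r) r →
      HasDerivAt (fun y => a j * (j.descFactorial k : ℝ) * y ^ (j - k))
        (a j * (j.descFactorial (k + 1) : ℝ) * y ^ (j - (k + 1))) y := by
    intro j y _
    have h := (hasDerivAt_pow (j - k) y).const_mul (a j * (j.descFactorial k : ℝ))
    refine h.congr_deriv ?_
    rw [Nat.descFactorial_succ, Nat.cast_mul, show j - k - 1 = j - (k + 1) by omega]
    ring
  have hbound : ∀ j y, y ∈ Ioo (-r) r → ‖a j * (j.descFactorial (k + 1) : ℝ) * y ^ (j - (k + 1))‖ ≤ u j := by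
    intro j y hy
    have hy' : |y| ≤ r := abs_le.2 ⟨le_of_lt hy.1, le_of_lt hy.2⟩
    rw [Real.norm_eq_abs, abs_mul, abs_mul, abs_of_nonneg (ha j), Nat.abs_cast, abs_pow]
    exact mul_le_mul_of_nonneg_left (pow_le_pow_left₀ (abs_nonneg y) hy' _)
      (mul_nonneg (ha j) (Nat.cast_nonneg _))
  have h0 : (0 : ℝ) ∈ Ioo (-r) r := ⟨by linarith, hr0⟩
  have hsum0 : Summable fun j => a j * (j.descFactorial k : ℝ) * (0 : ℝ) ^ (j - k) := by
    refine Summable.of_norm_bounded (summable_derivedSeries_term ha hρ hs k hr0 hrρ) fun j => ?_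
    rw [Real.norm_eq_abs, abs_mul, abs_mul, abs_of_nonneg (ha j), Nat.abs_cast, abs_pow, abs_zero]
    refine mul_le_mul_of_nonneg_left (pow_le_pow_left₀ le_rfl hr0.le _) (mul_nonneg (ha j) (Nat.cast_nonneg _))
  have hwmem : w ∈ Ioo (-r) r := ⟨by linarith [neg_abs_le w], lt_of_le_of_lt (le_abs_self w) hwr⟩
  exact hasDerivAt_tsum_of_isPreconnected hus isOpen_Ioo isPreconnected_Ioo hderiv hbound h0 hsum0 hwmem

/-- The iterated derivatives of the power series inside the radius are the derived series.
[cite: Widder1941, Ch. IV §2] -/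
theorem iteratedDeriv_derivedSeries (ha : ∀ j, 0 ≤ a j) (hρ : 0 < ρ) (hs : Summable fun j => a j * ρ ^ j)
    (n : ℕ) {w : ℝ} (hw : |w| < ρ) :
    iteratedDeriv n (derivedSeries a 0) w = derivedSeries a n w := by
  induction n generalizing w with
  | zero => simp
  | succ n ih =>
    rw [iteratedDeriv_succ]
    have hopen : Ioo (-ρ) ρ ∈ 𝓝 w := isOpen_Ioo.mem_nhds ⟨by linarith [neg_abs_le w, hw], lt_of_le_of_lt (le_abs_self w) hw⟩
    have heq : iteratedDeriv n (derivedSeries a 0) =ᶠ[𝓝 w] derivedSeries a n := by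
      filter_upwards [hopen] with v hv
      exact ih (abs_lt.2 ⟨hv.1, hv.2⟩)
    rw [heq.deriv_eq]
    exact (hasDerivAt_derivedSeries ha hρ hs n hw).deriv

/-- The derived series are `C^∞` on `(-ρ, ρ)`. [cite: Widder1941, Ch. IV §2] -/
theorem contDiffOn_derivedSeries (ha : ∀ j, 0 ≤ a j) (hρ : 0 < ρ) (hs : Summable fun j => a j * ρ ^ j)
    (k : ℕ) : ContDiffOn ℝ ∞ (derivedSeries a k) (Ioo (-ρ) ρ) := by
  have hmem : ∀ w ∈ Ioo (-ρ) ρ, |w| < ρ := fun w hw => abs_lt.2 ⟨hw.1, hw.2⟩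
  have key : ∀ n : ℕ, ∀ k, ContDiffOn ℝ n (derivedSeries a k) (Ioo (-ρ) ρ) := by
    intro n
    induction n with
    | zero =>
      intro k
      exact contDiffOn_zero.2 fun w hw =>
        (hasDerivAt_derivedSeries ha hρ hs k (hmem w hw)).continuousAt.continuousWithinAt
    | succ n ih =>
      intro k
      rw [Nat.cast_succ]
      refine (contDiffOn_succ_iff_deriv_of_isOpen isOpen_Ioo).2 ⟨?_, ?_, ?_⟩
      · exact fun w hw => (hasDerivAt_derivedSeries ha hρ hs k (hmem w hw)).differentiableAt.differentiableWithinAt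
      · intro h
        exact absurd h (by simp)
      · refine (ih (k + 1)).congr fun w hw => ?_
        exact (hasDerivAt_derivedSeries ha hρ hs k (hmem w hw)).deriv
  exact contDiffOn_infty.2 fun n => key n k

end Basic

/-! ## The mirror form: local nonnegative power series in `U - u` give complete monotonicity -/

section Mirror

/-- **Local nonnegative power series in `U - u` ⇒ completely monotone.**  If for every `U > 0` there are `a_j ≥ 0`
with `Σ a_j U^j < ∞` and `f(u) = Σ_j a_j (U - u)^j` for all `u ∈ [U/2, U]`, then `f` is `C^∞` on `(0,∞)` and
`(-1)^n f^{(n)}(u) ≥ 0` for all `u > 0` and `n`. [cite: Widder1941, Ch. IV §2 (Def. 2c, Thm 2b)] -/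
theorem completelyMonotone_of_local_powerSeries {f : ℝ → ℝ}
    (h : ∀ U : ℝ, 0 < U → ∃ a : ℕ → ℝ, (∀ j, 0 ≤ a j) ∧ Summable (fun j => a j * U ^ j) ∧
      ∀ u ∈ Icc (U / 2) U, HasSum (fun j => a j * (U - u) ^ j) (f u)) :
    ContDiffOn ℝ ∞ f (Ioi 0) ∧ ∀ (n : ℕ) (u : ℝ), 0 < u → 0 ≤ (-1 : ℝ) ^ n * iteratedDeriv n f u := by
  -- local representation around `u₀ > 0` with `U = 4u₀/3`
  have hloc : ∀ u₀ : ℝ, 0 < u₀ → ∃ a : ℕ → ℝ, (∀ j, 0 ≤ a j) ∧ Summable (fun j => a j * (4 * u₀ / 3) ^ j) ∧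
      f =ᶠ[𝓝 u₀] fun u => derivedSeries a 0 (4 * u₀ / 3 - u) := by
    intro u₀ hu₀
    obtain ⟨a, ha, hs, hsum⟩ := h (4 * u₀ / 3) (by positivity)
    refine ⟨a, ha, hs, ?_⟩
    have hnhds : Ioo (2 * u₀ / 3) (4 * u₀ / 3) ∈ 𝓝 u₀ := isOpen_Ioo.mem_nhds ⟨by linarith, by linarith⟩
    filter_upwards [hnhds] with u hu
    rw [derivedSeries_zero]
    exact ((hsum u ⟨by linarith [hu.1], le_of_lt hu.2⟩).tsum_eq).symm
  refine ⟨fun u₀ hu₀ => ?_, fun n u₀ hu₀ => ?_⟩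
  · have hu₀' : 0 < u₀ := hu₀
    obtain ⟨a, ha, hs, hfeq⟩ := hloc u₀ hu₀'
    have hU : 0 < 4 * u₀ / 3 := by positivity
    have hg : ContDiffAt ℝ ∞ (derivedSeries a 0) (4 * u₀ / 3 - u₀) :=
      (contDiffOn_derivedSeries ha hU hs 0).contDiffAt (isOpen_Ioo.mem_nhds ⟨by linarith, by linarith⟩)
    have hcomp : ContDiffAt ℝ ∞ (fun u => derivedSeries a 0 (4 * u₀ / 3 - u)) u₀ :=
      hg.comp u₀ (contDiffAt_const.sub contDiffAt_id)
    exact (hcomp.congr_of_eventuallyEq hfeq).contDiffWithinAt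
  · obtain ⟨a, ha, hs, hfeq⟩ := hloc u₀ hu₀
    have hU : 0 < 4 * u₀ / 3 := by positivity
    rw [hfeq.iteratedDeriv_eq n, iteratedDeriv_comp_const_sub n (derivedSeries a 0) (4 * u₀ / 3)]
    simp only [smul_eq_mul]
    rw [← mul_assoc, ← mul_pow, neg_one_mul, neg_neg, one_pow, one_mul,
      iteratedDeriv_derivedSeries ha hU hs n (by rw [abs_of_pos (by linarith)]; linarith)]
    exact derivedSeries_nonneg ha n (by linarith)

end Mirror

end Literature.Analysis.Calculus

end
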